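import Literature.MathematicalPhysics.QuantumFieldTheory.Balaban1983to89.T3TiltDescent
import Mathlib.MeasureTheory.Function.AEEqOfIntegral
import HarnessLib

/-!
# `Balaban1983to89.T3TowerWeightDensity` — the tower / fibre integral `T_{n,K}(g)` of a GENERAL top weight over the fine fields
# with prescribed height-`n` block averages (typing request `defn-TowerWeightDensity`, route `ReplicaVarianceTilt`, crux `HeightChiSqL`)

Cell `ym3-torus` (HUMAN RULING D-0037, YM ladder rung R3).  WHAT THIS IS NOT: not d = 4, not infinite volume, not a mass gap,
not Clay, not K1, and no bound of [Balaban1985UV3] is asserted: this file only CONSTRUCTS an object and proves its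
measure-theoretic bookkeeping.

THE OBJECT.  For a `T3Family` `F`, heights `n ≤ K` and a non-negative top weight `g` on the finest fields of the `K`-th
approximation (`GaugeField (F.P K) 0 SU(2) → ℝ`), **`towerWeightDensity F hK g`** is the density, with respect to product Haar
`fieldMeasure (F.P n) 0 SU(2)` on the finest fields of the `n`-th approximation, of the push-forward of `g · dU^{(K)}` along the
descent map `D_{n,K} = T3TiltDescent.descendTo F ℰp n K hK` (`K − n` block averagings (0.4) of [Balaban1987RG1], read on the
`n`-th tower by `T3LevelShift.fieldShift`): Bałaban's iterated renormalisation transformation `T_{K−n−1}⋯T_0 g`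
([Balaban1985UV3] (2) `ρ_{k+1} = Tρ_k`, [Balaban1985Averaging] (10) `(Tρ)(V) = ∫ dU δ(Ū V⁻¹) ρ(U)`) started from an ARBITRARY
`ρ₀ = g` — the tree's Radon–Nikodym tower `T3RestrictedUnitDensity.towerDensity F K g (K − n)` — read at the comparison scale
`η = L^{-n}`.  It GENERALISES `T3TiltDescent.heightDensity F γ hK S` (the case `g = 1_S · e^{−β_K A}`,
`heightDensity_eq_towerWeightDensity`, definitional) from indicator-restricted Boltzmann weights to general weights, so that
interpolated weights `h_s = 1_S e^{−(1−s)β_K A} w_K^s` and glued two-replica pressures `log ∫ T(h_s)T(h_{s'})/T(h_0) dμ_n` can be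
typed by the route.

CONTENTS (all proved; no named fact, no `sorry`): `towerWeightDensity` and its reading lemma `towerWeightDensity_fieldShift`;
`heightDensity_eq_towerWeightDensity`; non-negativity, measurability, integrability (`g ≥ 0` measurable, resp. integrable);
**the push-forward identity with a test function** `∫ T(g)·φ dμ_n = ∫ g·(φ ∘ D_{n,K}) dμ_K` for bounded measurable `φ`
(`integral_towerWeightDensity_mul`), its set form `∫_{s} T(g) dμ_n = ∫_{D⁻¹s} g dμ_K` and total mass `∫ T(g) dμ_n = ∫ g dμ_K`;
**the measure identity** `(D_{n,K})_*(g·μ_K) = T(g)·μ_n` (`map_descendTo_withDensity`); and the a.e. calculus in `g` that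
Radon–Nikodym versions allow: additivity `T(g₁+g₂) = T(g₁)+T(g₂)` a.e., homogeneity `T(c·g) = c·T(g)` a.e. (`c ≥ 0`),
monotonicity `g₁ ≤ g₂ ⇒ T(g₁) ≤ T(g₂)` a.e., and `g₁ = g₂` `μ_K`-a.e. ⇒ `T(g₁) = T(g₂)` `μ_n`-a.e.  The densities are VERSIONS
(defined through `Measure.rnDeriv` inside `T3UnitLawDensityEML.rt`), so the identities in `g` hold almost everywhere, not
pointwise; this is all the disintegration / coarea folklore the consumers need, in the push-forward reading of the tree
(`Setup.IsRT`, DIVERGENCE F7: no pointwise δ-functions).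

References: [Balaban1985UV3] T. Bałaban, CMP 102 (1985), (2) p.256, (6)-(7) p.257; [Balaban1985Averaging] T. Bałaban, CMP 98
(1985), (10) p.19; [Balaban1987RG1] T. Bałaban, CMP 109 (1987), (0.4), (0.11) p.253; [King1986] C. King, CMP 103 (1986) Thm 3.4
(the two-cut-off comparison these densities serve).  Tree: `T3RestrictedUnitDensity` (§1 `towerDensity`), `T3TiltDescent`
(`descendTo`, `heightDensity`), `T3LevelShift` (`fieldShift`).
-/

noncomputable section

open MeasureTheory Filter Topology
open Literature.MathematicalPhysics.QuantumFieldTheory.Balaban1983to89.T3ContinuumYM3Torus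
open Literature.MathematicalPhysics.QuantumFieldTheory.Balaban1983to89.T3LevelShift
open Literature.MathematicalPhysics.QuantumFieldTheory.Balaban1983to89.T3UnitLawDensityEML
open Literature.MathematicalPhysics.QuantumFieldTheory.Balaban1983to89.T3RestrictedUnitDensity
open Literature.MathematicalPhysics.QuantumFieldTheory.Balaban1983to89.T3TiltDescent
open Literature.MathematicalPhysics.QuantumFieldTheory.Balaban1983to89.Missing
open Literature.MathematicalPhysics.QuantumFieldTheory.Balaban1983to89.T4Continuum

namespace Literature.MathematicalPhysics.QuantumFieldTheory.Balaban1983to89.T3TowerWeightDensity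

/-! ## §1 The object and its reading on the `K`-th tower -/

section Defn

variable (F : T3Family) {n K : ℕ} (hK : n ≤ K)
  (g : GaugeField (F.P K) 0 (Matrix.specialUnitaryGroup (Fin 2) ℂ) → ℝ)

/-- **`T_{n,K}(g)`, THE TOWER DENSITY OF A GENERAL TOP WEIGHT AT THE COMPARISON SCALE** (`n ≤ K`): Bałaban's iterated
renormalisation transformation `T_{K−n−1}⋯T_0 g` of the weight `g` on the finest fields of the `K`-th approximation
(`towerDensity F K g (K − n)`, [Balaban1985UV3] (2) with `ρ₀ = g`), read on the finest lattice of the `n`-th approximation (same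
spacing `L^{-n}`, `fieldShift`) — the density of `(D_{n,K})_*(g · dU^{(K)})` with respect to `dU^{(n)}` (`map_descendTo_withDensity`).
[cite: Balaban1985UV3, (2) p.256] [cite: Balaban1985Averaging, (10) p.19] -/
def towerWeightDensity (V : GaugeField (F.P n) 0 (Matrix.specialUnitaryGroup (Fin 2) ℂ)) : ℝ :=
  towerDensity F K g (K - n)
    (fieldShift (F.sitesPerDir_eq (m := F.m) (K := K) (j := K - n) (m' := F.m) (K' := n) (j' := 0) (by omega)) V)

/-- Reading lemma: `T_{n,K}(g)` at the `n`-th-tower copy of a height-`(K−n)` field `W` of the `K`-th tower is `(T_{K−n−1}⋯T_0 g)(W)`.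
[cite: Balaban1985UV3, (2) p.256] -/
theorem towerWeightDensity_fieldShift (W : GaugeField (F.P K) (K - n) (Matrix.specialUnitaryGroup (Fin 2) ℂ)) :
    towerWeightDensity F hK g
        (fieldShift (F.sitesPerDir_eq (m := F.m) (K := n) (j := 0) (m' := F.m) (K' := K) (j' := K - n) (by omega)) W) =
      towerDensity F K g (K - n) W := by
  unfold towerWeightDensity
  rw [fieldShift_fieldShift, fieldShift_refl]

/-- **`heightDensity` IS THE CASE `g = 1_S · e^{−β_K A}`** (definitionally): the restricted density of `T3TiltDescent` is the tower
density of the indicator-restricted Boltzmann weight. [cite: Balaban1985UV3, (2) p.256 and (7) p.257] -/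
theorem heightDensity_eq_towerWeightDensity (γ : ℝ) (S : Set (GaugeField (F.P K) 0 (Matrix.specialUnitaryGroup (Fin 2) ℂ))) :
    heightDensity F γ hK S =
      towerWeightDensity F hK (S.indicator (boltzmann (F.P K) ((F.scheme ℰp γ).β K))) := rfl

variable {g}

/-- `T_{n,K}(g) ≥ 0` for `g ≥ 0`. [cite: Balaban1985UV3, (2) p.256] -/
theorem towerWeightDensity_nonneg (h0 : ∀ U, 0 ≤ g U) (V : GaugeField (F.P n) 0 (Matrix.specialUnitaryGroup (Fin 2) ℂ)) :
    0 ≤ towerWeightDensity F hK g V :=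
  towerDensity_nonneg F K h0 _ _

/-- `T_{n,K}(g)` is measurable for `g ≥ 0` measurable (Radon–Nikodym derivatives are). [cite: Balaban1985UV3, (2) p.256] -/
theorem measurable_towerWeightDensity (h0 : ∀ U, 0 ≤ g U) (hm : Measurable g) :
    Measurable (towerWeightDensity F hK g) :=
  (measurable_towerDensity F K h0 hm (K - n)).comp (measurable_fieldShift _)

/-- `T_{n,K}(g)` is integrable for `g` integrable (`fieldShift` preserves product Haar). [cite: Balaban1985UV3, (6) p.257] -/
theorem integrable_towerWeightDensity
    (hi : Integrable g (fieldMeasure (F.P K) 0 (Matrix.specialUnitaryGroup (Fin 2) ℂ))) :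
    Integrable (towerWeightDensity F hK g) (fieldMeasure (F.P n) 0 (Matrix.specialUnitaryGroup (Fin 2) ℂ)) :=
  (measurePreserving_fieldShift _).integrable_comp_of_integrable (integrable_towerDensity F K hi (K - n) (by omega))

end Defn

/-! ## §2 The push-forward identities -/

section Push

variable (F : T3Family) {n K : ℕ} (hK : n ≤ K)
  {g : GaugeField (F.P K) 0 (Matrix.specialUnitaryGroup (Fin 2) ℂ) → ℝ}

/-- **THE PUSH-FORWARD IDENTITY WITH A TEST FUNCTION** (the fibre integral / disintegration along the block-averaging fibration,
in the tree's push-forward reading): for `g` integrable and `φ` bounded measurable on the `n`-th tower's finest fields,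
`∫ T_{n,K}(g)(V)·φ(V) dU^{(n)}(V) = ∫ g(U)·φ(D_{n,K}U) dU^{(K)}(U)`. [cite: Balaban1985Averaging, (10) p.19] -/
theorem integral_towerWeightDensity_mul
    (hi : Integrable g (fieldMeasure (F.P K) 0 (Matrix.specialUnitaryGroup (Fin 2) ℂ)))
    (φ : GaugeField (F.P n) 0 (Matrix.specialUnitaryGroup (Fin 2) ℂ) → ℝ) (hφ : Measurable φ) (hC : ∃ C : ℝ, ∀ V, |φ V| ≤ C) :
    ∫ V, towerWeightDensity F hK g V * φ V ∂fieldMeasure (F.P n) 0 (Matrix.specialUnitaryGroup (Fin 2) ℂ) =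
      ∫ U, g U * φ (descendTo F ℰp n K hK U) ∂fieldMeasure (F.P K) 0 (Matrix.specialUnitaryGroup (Fin 2) ℂ) := by
  obtain ⟨C, hC⟩ := hC
  have hcv : ∫ V, towerWeightDensity F hK g V * φ V ∂fieldMeasure (F.P n) 0 (Matrix.specialUnitaryGroup (Fin 2) ℂ) =
      ∫ W, towerWeightDensity F hK g
          (fieldShift (F.sitesPerDir_eq (m := F.m) (K := n) (j := 0) (m' := F.m) (K' := K) (j' := K - n) (by omega)) W) *
        φ (fieldShift (F.sitesPerDir_eq (m := F.m) (K := n) (j := 0) (m' := F.m) (K' := K) (j' := K - n) (by omega)) W)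
        ∂fieldMeasure (F.P K) (K - n) (Matrix.specialUnitaryGroup (Fin 2) ℂ) :=
    (integral_comp_fieldShift _ (fun V => towerWeightDensity F hK g V * φ V)).symm
  rw [hcv]
  simp_rw [towerWeightDensity_fieldShift]
  exact integral_towerDensity_mul F K hi (K - n) (by omega) (fun W => φ (fieldShift _ W))
    (hφ.comp (measurable_fieldShift _)) ⟨C, fun W => hC _⟩

/-- **TOTAL MASS**: `∫ T_{n,K}(g) dU^{(n)} = ∫ g dU^{(K)}` (`φ = 1`). [cite: Balaban1985Averaging, (10) p.19] -/
theorem integral_towerWeightDensity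
    (hi : Integrable g (fieldMeasure (F.P K) 0 (Matrix.specialUnitaryGroup (Fin 2) ℂ))) :
    ∫ V, towerWeightDensity F hK g V ∂fieldMeasure (F.P n) 0 (Matrix.specialUnitaryGroup (Fin 2) ℂ) =
      ∫ U, g U ∂fieldMeasure (F.P K) 0 (Matrix.specialUnitaryGroup (Fin 2) ℂ) := by
  have h := integral_towerWeightDensity_mul F hK hi (fun _ => (1 : ℝ)) measurable_const ⟨1, fun _ => by simp⟩
  simpa using h

/-- **SET FORM**: `∫_{s} T_{n,K}(g) dU^{(n)} = ∫_{D_{n,K}⁻¹ s} g dU^{(K)}` for measurable `s` (`φ = 1_s`).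
[cite: Balaban1985Averaging, (10) p.19] -/
theorem setIntegral_towerWeightDensity
    (hi : Integrable g (fieldMeasure (F.P K) 0 (Matrix.specialUnitaryGroup (Fin 2) ℂ)))
    {s : Set (GaugeField (F.P n) 0 (Matrix.specialUnitaryGroup (Fin 2) ℂ))} (hs : MeasurableSet s) :
    ∫ V in s, towerWeightDensity F hK g V ∂fieldMeasure (F.P n) 0 (Matrix.specialUnitaryGroup (Fin 2) ℂ) =
      ∫ U in descendTo F ℰp n K hK ⁻¹' s, g U ∂fieldMeasure (F.P K) 0 (Matrix.specialUnitaryGroup (Fin 2) ℂ) := by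
  have hb : ∀ V, |s.indicator (fun _ => (1 : ℝ)) V| ≤ 1 := fun V => by
    by_cases hV : V ∈ s
    · simp [hV]
    · simp [hV]
  have h := integral_towerWeightDensity_mul F hK hi (s.indicator fun _ => (1 : ℝ)) (measurable_const.indicator hs) ⟨1, hb⟩
  rw [← integral_indicator hs, ← integral_indicator ((measurable_descendTo F ℰp measurableE_ℰp hK) hs)]
  have h1 : (fun V => s.indicator (towerWeightDensity F hK g) V) =
      fun V => towerWeightDensity F hK g V * s.indicator (fun _ => (1 : ℝ)) V := by
    funext V
    by_cases hV : V ∈ s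
    · rw [Set.indicator_of_mem hV, Set.indicator_of_mem hV, mul_one]
    · rw [Set.indicator_of_notMem hV, Set.indicator_of_notMem hV, mul_zero]
  have h2 : (fun U => (descendTo F ℰp n K hK ⁻¹' s).indicator g U) =
      fun U => g U * s.indicator (fun _ => (1 : ℝ)) (descendTo F ℰp n K hK U) := by
    funext U
    by_cases hU : descendTo F ℰp n K hK U ∈ s
    · rw [Set.indicator_of_mem (show U ∈ descendTo F ℰp n K hK ⁻¹' s from hU), Set.indicator_of_mem hU, mul_one]
    · rw [Set.indicator_of_notMem (show U ∉ descendTo F ℰp n K hK ⁻¹' s from hU), Set.indicator_of_notMem hU,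
        mul_zero]
  rw [h1, h2]
  exact h

/-- Two finite measures with equal integrals of all measurable `f`, `|f| ≤ 1`, are equal (local helper). [folklore] -/
private theorem ext_of_forall_integral_eq {X : Type*} [MeasurableSpace X] {μ ν : Measure X} [IsFiniteMeasure μ]
    [IsFiniteMeasure ν] (h : ∀ f : X → ℝ, Measurable f → (∀ x, |f x| ≤ 1) → ∫ x, f x ∂μ = ∫ x, f x ∂ν) : μ = ν := by
  refine Measure.ext fun s hs => ?_
  have hb : ∀ y, |s.indicator (1 : X → ℝ) y| ≤ 1 := fun y => by
    by_cases hy : y ∈ s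
    · simp [hy]
    · simp [hy]
  have h1 := h _ (measurable_one.indicator hs) hb
  rw [integral_indicator_one hs, integral_indicator_one hs] at h1
  exact (ENNReal.toReal_eq_toReal_iff' (measure_ne_top _ _) (measure_ne_top _ _)).mp h1

/-- **THE MEASURE IDENTITY**: for `g ≥ 0` measurable and integrable, the push-forward along `D_{n,K}` of `g · dU^{(K)}` IS
`T_{n,K}(g) · dU^{(n)}`: `(D_{n,K})_*(μ_K.withDensity g) = μ_n.withDensity (T_{n,K} g)`. [cite: Balaban1985Averaging, (10) p.19]
[cite: Balaban1985UV3, (2) p.256] -/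
theorem map_descendTo_withDensity (h0 : ∀ U, 0 ≤ g U) (hm : Measurable g)
    (hi : Integrable g (fieldMeasure (F.P K) 0 (Matrix.specialUnitaryGroup (Fin 2) ℂ))) :
    Measure.map (descendTo F ℰp n K hK)
        ((fieldMeasure (F.P K) 0 (Matrix.specialUnitaryGroup (Fin 2) ℂ)).withDensity fun U => ENNReal.ofReal (g U)) =
      (fieldMeasure (F.P n) 0 (Matrix.specialUnitaryGroup (Fin 2) ℂ)).withDensity fun V =>
        ENNReal.ofReal (towerWeightDensity F hK g V) := by
  have hD := measurable_descendTo F ℰp measurableE_ℰp hK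
  haveI : IsFiniteMeasure ((fieldMeasure (F.P K) 0 (Matrix.specialUnitaryGroup (Fin 2) ℂ)).withDensity
      fun U => ENNReal.ofReal (g U)) :=
    isFiniteMeasure_withDensity_ofReal hi.2
  haveI : IsFiniteMeasure (Measure.map (descendTo F ℰp n K hK)
      ((fieldMeasure (F.P K) 0 (Matrix.specialUnitaryGroup (Fin 2) ℂ)).withDensity fun U => ENNReal.ofReal (g U))) :=
    Measure.isFiniteMeasure_map _ _
  haveI : IsFiniteMeasure ((fieldMeasure (F.P n) 0 (Matrix.specialUnitaryGroup (Fin 2) ℂ)).withDensity fun V =>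
      ENNReal.ofReal (towerWeightDensity F hK g V)) :=
    isFiniteMeasure_withDensity_ofReal (integrable_towerWeightDensity F hK hi).2
  refine ext_of_forall_integral_eq fun f hf hb => ?_
  rw [integral_map hD.aemeasurable hf.aestronglyMeasurable,
    T4VarianceMatching.integral_withDensity_ofReal_mul hm h0,
    T4VarianceMatching.integral_withDensity_ofReal_mul (measurable_towerWeightDensity F hK h0 hm)
      (towerWeightDensity_nonneg F hK h0),
    integral_towerWeightDensity_mul F hK hi f hf ⟨1, hb⟩]

end Push

/-! ## §3 The almost-everywhere calculus in the weight -/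

section Calculus

variable (F : T3Family) {n K : ℕ} (hK : n ≤ K)
  {g g₁ g₂ : GaugeField (F.P K) 0 (Matrix.specialUnitaryGroup (Fin 2) ℂ) → ℝ}

/-- **ADDITIVITY a.e.**: `T_{n,K}(g₁ + g₂) = T_{n,K}(g₁) + T_{n,K}(g₂)` `μ_n`-almost everywhere (`gᵢ ≥ 0` measurable integrable) — both
sides have the same integral over every measurable set (`setIntegral_towerWeightDensity`). [cite: Balaban1985Averaging, (10) p.19] -/
theorem towerWeightDensity_add_ae
    (hi₁ : Integrable g₁ (fieldMeasure (F.P K) 0 (Matrix.specialUnitaryGroup (Fin 2) ℂ)))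
    (hi₂ : Integrable g₂ (fieldMeasure (F.P K) 0 (Matrix.specialUnitaryGroup (Fin 2) ℂ))) :
    towerWeightDensity F hK (g₁ + g₂) =ᵐ[fieldMeasure (F.P n) 0 (Matrix.specialUnitaryGroup (Fin 2) ℂ)]
      towerWeightDensity F hK g₁ + towerWeightDensity F hK g₂ := by
  refine Integrable.ae_eq_of_forall_setIntegral_eq _ _ (integrable_towerWeightDensity F hK (hi₁.add hi₂))
    ((integrable_towerWeightDensity F hK hi₁).add (integrable_towerWeightDensity F hK hi₂)) fun s hs _ => ?_
  rw [integral_add' (integrable_towerWeightDensity F hK hi₁).integrableOn (integrable_towerWeightDensity F hK hi₂).integrableOn,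
    setIntegral_towerWeightDensity F hK (hi₁.add hi₂) hs, setIntegral_towerWeightDensity F hK hi₁ hs,
    setIntegral_towerWeightDensity F hK hi₂ hs, ← integral_add' hi₁.integrableOn hi₂.integrableOn]

/-- **HOMOGENEITY a.e.**: `T_{n,K}(c·g) = c·T_{n,K}(g)` `μ_n`-almost everywhere (`g` integrable, any real `c`).
[cite: Balaban1985Averaging, (10) p.19] -/
theorem towerWeightDensity_const_mul_ae
    (hi : Integrable g (fieldMeasure (F.P K) 0 (Matrix.specialUnitaryGroup (Fin 2) ℂ))) (c : ℝ) :
    towerWeightDensity F hK (fun U => c * g U) =ᵐ[fieldMeasure (F.P n) 0 (Matrix.specialUnitaryGroup (Fin 2) ℂ)]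
      fun V => c * towerWeightDensity F hK g V := by
  refine Integrable.ae_eq_of_forall_setIntegral_eq _ _ (integrable_towerWeightDensity F hK (hi.const_mul c))
    ((integrable_towerWeightDensity F hK hi).const_mul c) fun s hs _ => ?_
  rw [integral_const_mul, setIntegral_towerWeightDensity F hK (hi.const_mul c) hs, setIntegral_towerWeightDensity F hK hi hs,
    integral_const_mul]

/-- **MONOTONICITY a.e.**: `g₁ ≤ g₂` pointwise ⇒ `T_{n,K}(g₁) ≤ T_{n,K}(g₂)` `μ_n`-almost everywhere (`gᵢ` integrable).
[cite: Balaban1985Averaging, (10) p.19] -/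
theorem towerWeightDensity_mono_ae
    (hi₁ : Integrable g₁ (fieldMeasure (F.P K) 0 (Matrix.specialUnitaryGroup (Fin 2) ℂ)))
    (hi₂ : Integrable g₂ (fieldMeasure (F.P K) 0 (Matrix.specialUnitaryGroup (Fin 2) ℂ))) (hle : ∀ U, g₁ U ≤ g₂ U) :
    towerWeightDensity F hK g₁ ≤ᵐ[fieldMeasure (F.P n) 0 (Matrix.specialUnitaryGroup (Fin 2) ℂ)]
      towerWeightDensity F hK g₂ := by
  refine ae_le_of_forall_setIntegral_le (integrable_towerWeightDensity F hK hi₁) (integrable_towerWeightDensity F hK hi₂)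
    fun s hs _ => ?_
  rw [setIntegral_towerWeightDensity F hK hi₁ hs, setIntegral_towerWeightDensity F hK hi₂ hs]
  exact setIntegral_mono hi₁.integrableOn hi₂.integrableOn hle

/-- **MONOTONICITY a.e. from an a.e. inequality of the weights** (`g₁ ≤ g₂` `μ_K`-a.e.). [cite: Balaban1985Averaging, (10) p.19] -/
theorem towerWeightDensity_mono_ae_of_ae_le
    (hi₁ : Integrable g₁ (fieldMeasure (F.P K) 0 (Matrix.specialUnitaryGroup (Fin 2) ℂ)))
    (hi₂ : Integrable g₂ (fieldMeasure (F.P K) 0 (Matrix.specialUnitaryGroup (Fin 2) ℂ)))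
    (hle : g₁ ≤ᵐ[fieldMeasure (F.P K) 0 (Matrix.specialUnitaryGroup (Fin 2) ℂ)] g₂) :
    towerWeightDensity F hK g₁ ≤ᵐ[fieldMeasure (F.P n) 0 (Matrix.specialUnitaryGroup (Fin 2) ℂ)]
      towerWeightDensity F hK g₂ := by
  refine ae_le_of_forall_setIntegral_le (integrable_towerWeightDensity F hK hi₁) (integrable_towerWeightDensity F hK hi₂)
    fun s hs _ => ?_
  rw [setIntegral_towerWeightDensity F hK hi₁ hs, setIntegral_towerWeightDensity F hK hi₂ hs]
  exact setIntegral_mono_ae hi₁.integrableOn hi₂.integrableOn hle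

/-- **VERSIONS**: weights equal `μ_K`-a.e. have tower densities equal `μ_n`-a.e. [cite: Balaban1985Averaging, (10) p.19] -/
theorem towerWeightDensity_congr_ae
    (hi₁ : Integrable g₁ (fieldMeasure (F.P K) 0 (Matrix.specialUnitaryGroup (Fin 2) ℂ)))
    (hi₂ : Integrable g₂ (fieldMeasure (F.P K) 0 (Matrix.specialUnitaryGroup (Fin 2) ℂ)))
    (heq : g₁ =ᵐ[fieldMeasure (F.P K) 0 (Matrix.specialUnitaryGroup (Fin 2) ℂ)] g₂) :
    towerWeightDensity F hK g₁ =ᵐ[fieldMeasure (F.P n) 0 (Matrix.specialUnitaryGroup (Fin 2) ℂ)]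
      towerWeightDensity F hK g₂ :=
  (towerWeightDensity_mono_ae_of_ae_le F hK hi₁ hi₂ heq.le).antisymm
    (towerWeightDensity_mono_ae_of_ae_le F hK hi₂ hi₁ heq.symm.le)

/-- **SUPPORT**: if `g = 0` `μ_K`-a.e. on `D_{n,K}⁻¹ s` then `T_{n,K}(g) = 0` `μ_n`-a.e. on `s` — in integrated form,
`∫_s T_{n,K}(g) dμ_n = 0` (`g` integrable, `s` measurable). [cite: Balaban1985Averaging, (10) p.19] -/
theorem setIntegral_towerWeightDensity_eq_zero
    (hi : Integrable g (fieldMeasure (F.P K) 0 (Matrix.specialUnitaryGroup (Fin 2) ℂ)))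
    {s : Set (GaugeField (F.P n) 0 (Matrix.specialUnitaryGroup (Fin 2) ℂ))} (hs : MeasurableSet s)
    (hz : ∀ᵐ U ∂fieldMeasure (F.P K) 0 (Matrix.specialUnitaryGroup (Fin 2) ℂ), U ∈ descendTo F ℰp n K hK ⁻¹' s → g U = 0) :
    ∫ V in s, towerWeightDensity F hK g V ∂fieldMeasure (F.P n) 0 (Matrix.specialUnitaryGroup (Fin 2) ℂ) = 0 := by
  rw [setIntegral_towerWeightDensity F hK hi hs]
  exact setIntegral_eq_zero_of_ae_eq_zero hz

end Calculus

end Literature.MathematicalPhysics.QuantumFieldTheory.Balaban1983to89.T3TowerWeightDensity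

end
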